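import Mathlib
import HarnessLib
import HarnessLib.Audit
import Summits.QuantumAdvantage.Statement
import Literature.Computability.MetaComplexity.DistProblems
import Literature.Computability.MetaComplexity.HeuristicClasses
import Literature.Computability.Cryptography.DLogHalf

/-!
Route: AvgCase

CLOSED (superseded) 2026-08-15T10:42:09Z by planner-QuantumAdvantage-route-QuantumAdvantage-AvgCase-0 — reason: superseded:route-QuantumAdvantage-Shor — superseded by route-QuantumAdvantage-Shor — note: route-repair (cone guardrail): CLOSED as superseded. (1) Cone: none of the 10 unproved cone facts is used by any AvgCase decl (needs-fact: none). All 10 enter through the operator-owned Summits/QuantumAdvantage/QuantumAdvantage/Statement.lean, whose imports Literature.Computability.QuantumComplexity. The file is kept as the record of this route; refuted decls are indexed as negative knowledge (`ledger negatives`).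

# Route QuantumAdvantage/AvgCase — a BQP language hard on average for BPP

## Thesis X
Words: some language in BQP, paired with some polynomial-time samplable input ensemble, admits no
randomized heuristic scheme (is not in HeurBPP).
Lean:  `∃ L ∈ Literature.Computability.Cryptography.BQP, ∃ D ∈
Literature.Computability.MetaComplexity.PSamp, (⟨L, D⟩ :
Literature.Computability.MetaComplexity.DistProblem) ∉
Literature.Computability.MetaComplexity.HeurBPP`

## Assembly (X → Statement)
`X → QuantumAdvantage`, via crux 3: every BPP language is in HeurBPP on every ensemble (a BPP
machine ignoring the parameters n, m is a heuristic scheme with empty error set after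
amplification).

## Why this line (PROBLEMS.md §3, bullet 2)
X is a STRENGTHENING of S: it asks for an average-case lower bound, the form in which essentially
all
known unconditional classical lower-bound techniques (random restrictions, discrepancy/lifting,
Forrelation-type Fourier bounds as in RazTal2022) and all cryptographic hardness (one-wayness) are
phrased. Imported field: average-case complexity (BogdanovTrevisan2006 Def. 2.12–2.13, Levin) via
the existing `Literature.CplxMeta` classes. Two instantiations: (a) number-theoretic — DLOG is
random
self-reducible (BlumMicali1984), so worst-case `DLOG ∉ BPP` already yields X with Shor1997 §6;
(b) speculative — white-box k-fold FORRELATION (AaronsonAmbainis2018) over a samplable pseudorandom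
circuit ensemble. The Aaronson–Ambainis conjecture (AaronsonAmbainis2014) is the standing warning:
for unstructured (uniform) inputs to black-box-style problems, quantum decision advantage on average
is conjectured impossible, so D must carry structure.

## Ranked cruxes
2. (informal; needs def `DLOGHalf`) Let DLOGHalf = {⟨p,g,y⟩ : IsDLogInstance p g y ∧ log_g y <
(p-1)/2}
   (the Blum–Micali predicate). For every P-uniform sequence of groups (p_n, g_n) (computable from
1^n):
   if DLOG SEARCH over (p_n, g_n) is not solvable by a PPT algorithm (worst case in y ⇔ average case
in
   y, by random self-reduction) then (DLOGHalf, D) ∉ HeurBPP for the samplable ensemble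
   D_n = ⟨p_n, g_n, uniform unit y⟩ [BlumMicali1984 Thm 2: a 1/2+1/poly predictor for the half
   predicate on random y yields DLOG search]; AND DLOGHalf ∈ BQP [Shor1997 §6]. Gives X.
3. `∀ L ∈ Literature.Computability.Complexity.BPP, ∀ D :
Literature.Computability.MetaComplexity.Ensemble, (⟨L, D⟩ :
Literature.Computability.MetaComplexity.DistProblem) ∈
Literature.Computability.MetaComplexity.HeurBPP`
   — the assembly lemma (needs BPP error reduction below 1/4).
4. (informal, speculative; needs def `kForrelationProblem`) there is a P-samplable ensemble of pairs
of
   Boolean circuits on which white-box FORRELATION (a PromiseBQP-complete promise problem,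
   AaronsonAmbainis2018) is HeurBPP-hard as a distributional problem on its promise.

## Kill criteria
- Proof that `distClass BQP PSamp ⊆ HeurBPP` follows from a standard derandomization hypothesis
  would make X strictly harder than S with no gain → close.
- Crux 2 refuted as typed (e.g. random self-reduction fails for the threshold-decision version) →
  re-type with the search version + crux 4 of route Shor.

## NOT decomposed yet
Choice of ensemble in (b); any lifting theorem; relation to one-way functions
(`Literature.Computability.Cryptography.IsOneWay`).

Sources: BogdanovTrevisan2006, BlumMicali1984, Shor1997, AaronsonAmbainis2014, AaronsonAmbainis2018,
RazTal2022.

UNDER FLOOR: fewer than 2 cruxes remain after retriage (legacy route; D-0019).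

Novelty: NOVELTY (searched: lit search/ --hybrid/vsearch "average-case hardness BQP samplable heuristic",
"quantum advantage from one-way functions", "cryptographic characterization of quantum advantage").
Nearest prior art: (1) line (a) is folklore = BlumMicali1984 §3.3 Thm 3 (half predicate hard on
average over uniform y iff DLOG) + Shor1997 §6; (2) AaronsonChen2017 Thm 7.6 (arXiv:1612.05903
p.30): OWF gives O in P/poly with BPP^O != BQP^O, the oracle shadow of "crypto implies advantage";
p.9 "advantage of sampling problems over decision problems"; (3) Morimae-Yamakawa arXiv:2302.04749
(OWF implies inefficient-verifier proofs of quantumness), Morimae-Shirakawa-Yamakawa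
arXiv:2410.00499 Thm 1.1 (IV-PoQ iff one-way puzzles), KMCVY arXiv:2104.00687 (DDH gives a proof of
quantumness): cryptographic characterisations of AVERAGE-CASE advantage, but for
interactive/sampling tasks, not languages; (4) AaronsonAmbainis2014 Conj 4/Thm 7(iii)
(arXiv:0911.0996 p.5): the obstruction for unstructured inputs; vocabulary BogdanovTrevisan2006 Def
2.12-2.13. Delta: X casts advantage-that-survives-averaging as a LANGUAGE-level distributional
separation, (BQP, PSamp) not inside HeurBPP (heuristic schemes, not samplers/verifiers), typed over
the tree's RandAlg/PSamp/HeurBPP; (a) formalises the folklore DLOG chain modulo two named facts; (b)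
white-box poly-fold Forrelation (AaronsonAmbainis2018 Thm 5) on a samplable ensemble is not in
print. Grade guess: variant (a), new-combination (b).  [refs: 1612.05903, 2302.04749, 2410.00499, 2104.00687, 0911.0996, BlumMicali1984, Shor1997, AaronsonChen2017, AaronsonAmbainis2014, BogdanovTrevisan2006, AaronsonAmbainis2018]

Barriers (technique_class: average-case; worst-to-average; crypto; class-separation): Literature.Barriers.QuantumAdvantage.SeparationPrerequisites : APPLIES in full (X implies the
summit, so PP not in BPP, P != P^#P, P != PSPACE); not evaded: X comes CONDITIONALLY (DLOG hardness,
line (a)) or the difficulty is restated (crux (b) = AvgForrelationWhitebox).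
Literature.Barriers.QuantumAdvantage.Relativization and
Literature.Barriers.QuantumAdvantage.Algebrization : any unconditional proof of X must be
non-relativizing, non-algebrizing (PSPACE-complete A: BQP^A inside BPP^A inside HeurBPP^A); (a) is
exempt only because "DLOG not in BPP implies X" is a theorem with an unrelativized STRUCTURED
hypothesis (Shor); cf. both entries, evasions_known.
Literature.Barriers.QuantumAdvantage.SupremacyTheoremsNonRelativizing (c): Fortnow-Rogers Thm 4.2
(oracle with OWF and P = BQP) blocks a relativizing upgrade of (a) from DLOG to GENERIC OWF; not
attempted (OWF-based IV-PoQ is interactive, not a language).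
Literature.Barriers.QuantumAdvantage.RandomOracleMethod : AA14 Thm 7(iii), random-oracle BQP inside
AvgP unless P != P^#P (given the AA conjecture), bears on (b); evaded only by STRUCTURED
(pseudorandom, white-box) ensembles: the unproven bet of crux (b).
Literature.Barriers.QuantumAdvantage.PPolyOracles : Aaronson-Chen Thm 8.1/7.6, even P/poly-ORACLE
separations need SampBPP != SampBQP or NP not in BPP, and follow from OWF; white-box (b) does not
evade; its bet (pseudorandomness planted in explicit circuits) has no support in print.
NaturalProofs, TotalFnSpeedupLimit: n/a.

History (route lifecycle, newest last):
- 2026-08-15T10:42:09Z · CLOSED superseded — superseded:route-QuantumAdvantage-Shor (planner-QuantumAdvantage-route-QuantumAdvantage-AvgCase-0)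

sub-problem: QuantumAdvantage · status: closed(superseded) · opened planner-QuantumAdvantage-Survey-0 2026-08-13T06:04:27Z · rev 1 · ledger route-QuantumAdvantage-AvgCase
GENERATED by the gate from the ledger (D-0016/17). Provers cite these decls: `theorem foo : Summit.QuantumAdvantage.QuantumAdvantage.Theses.AvgCase.<Decl> := …` in Summits/QuantumAdvantage/QuantumAdvantage/Theorems/<Name>.lean.
-/

namespace Summit.QuantumAdvantage.QuantumAdvantage.Theses.AvgCase

open scoped BigOperators Topology Manifold Classical MeasureTheory ProbabilityTheory Matrix InnerProductSpace ComplexConjugate ContinuousMap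
open Filter Set Function TopologicalSpace MeasureTheory

attribute [summit_statement] _root_.QuantumAdvantage

open Literature.QuantumAdvantage

/-- item stmt-QuantumAdvantage-0237 · target · rank 0 · closed · moot by None · by planner
why it might fail: X implies the summit, so PP not in BPP and P != PSPACE (SeparationPrerequisites): out of reach unconditionally; false if BQP = BPP. Advantage surviving averaging needs structure: AA14 Conj 4/Thm 7(iii) (random-oracle BQP in AvgP unless P != P^#P); print has only conditional instances.
sources: AaronsonAmbainis2014 (arXiv:0911.0996) p.5 Conj 4 and Thm 7(iii), proof p.14, AaronsonChen2017 (arXiv:1612.05903) Thm 7.6 p.30, Thm 8.1 p.32, p.9 (sampling vs decision), Literature.Barriers.QuantumAdvantage.SeparationPrerequisites (BernsteinVazirani1997 §1, Thm 8.6), BogdanovTrevisan2006 Def 2.12-2.13 (HeurBPP; corroborated itcs-2022-85 p.8 Def 3), arXiv:2410.00499 Thm 1.1 p.3 (IV-PoQ iff one-way puzzles: the interactive/sampling analogue)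
Thesis X of route AvgCase (PROBLEMS.md §3 bullet 2): a BQP language with a polynomial-time samplable
ensemble admitting no randomized heuristic scheme. Strictly stronger than BQP ≠ BPP.
[BogdanovTrevisan2006 Def. 2.12–2.13] -/
@[route_item "route-QuantumAdvantage-AvgCase"]
def AvgThesis : Prop :=
  ∃ L ∈ Literature.Computability.Cryptography.BQP, ∃ D ∈ Literature.Computability.MetaComplexity.PSamp, (⟨L, D⟩ : Literature.Computability.MetaComplexity.DistProblem) ∉ Literature.Computability.MetaComplexity.HeurBPP

-- TODO item stmt-QuantumAdvantage-0241 · crux · rank 4 · closed · moot by None · by planner — BLOCKED: missing decl(s) Literature.Computability.QuantumComplexity.kForrelationProblem.no, Literature.Computability.QuantumComplexity.kForrelationProblem.yes; restate via `ledger route edit` once they land: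
--   def AvgForrelationWhitebox : Prop := ∃ D ∈ Literature.Computability.MetaComplexity.PSamp, ∃ L ∈ Literature.Computability.Cryptography.BQP, (∀ n, ((D n).support : Set (List Bool)) ⊆ Literature.Computability.QuantumComplexity.kForrelationProblem.yes ∪ Literature.Computability.QuantumComplexity.kForrelationProblem.no) ∧ (∀ n, ∀ x ∈ (D n).

/-- item stmt-QuantumAdvantage-0239 · support · rank 2 · closed · moot by None · by planner
why it might fail: Not mathematically (Blum-Micali 1984 Thm 3). Vocabulary risks only, absorbed by the signature: witness D must be a dyadic exact-PSamp sampler 2^-n-close to uniform (the uniform dlogHalfEnsemble is NOT in PSamp); antecedent may be vacuous (no P-uniform poly-bit prime+generator family is known).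
sources: BlumMicali1984 §3.3 Thm 3 p.858 (= FOCS 1982 Thm 2: paper:doi-10-1109-sfcs-1982-72 p.4, with Remark 1), Literature.Computability.Cryptography.blumMicali_halfPredicate_dlog (Literature/Computability/Cryptography/BlumMicali.lean:211, per-(p,g) Monte-Carlo oracle form), Literature.Computability.MetaComplexity.Ensemble.IsPolySamplable (DistProblems.lean:123): exact sampler, RandAlg.outputPMF uniform on coinLen coins => dyadic masses; dlogHalfEnsemble_apply_encode gives 1/(p-1), arXiv:1009.3956 (Polymath4, Math. Comp. 81 (2012)) p.3: deterministic poly-time prime finding is open (poly only under Cramer), Shor1997 §6 (arXiv:quant-ph/9508027 p.16-18)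
Let DLOGHalf = {⟨p,g,y⟩ : IsDLogInstance p g y ∧ (the a < p-1 with g^a ≡ y mod p) < (p-1)/2}
(Blum–Micali predicate; encoding as in Literature.Computability.Cryptography.encodeDLogInstance).
CLAIM: for every sequence (p_n, g_n) of DLOG instances computable from 1^n in polynomial time, if no
PPT algorithm solves DLOG search over (p_n, g_n) (for all large n, on every unit y, with probability
≥ 2/3), then (DLOGHalf, D) ∉ Literature.Computability.MetaComplexity.HeurBPP where D_n = law of
encodeDLogInstance p_n g_n y, y uniform in [1, p_n) (D ∈ PSamp); moreover DLOGHalf ∈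
Literature.Computability.Cryptography.BQP. Proof in print: a predictor for the half predicate
correct on 1/2 + 1/poly of random y yields DLOG search (BlumMicali1984 §3–4), random
self-reducibility in y; membership in BQP by Shor's DLOG algorithm plus comparison (Shor1997 §6;
primality of p and primitivity of g are BQP-checkable). Together these give thesis X from a
worst-case number-theoretic hypothesis. NEEDS DEFINITION: DLOGHalf : Language Bool (and its
ensemble).  [needs_definition: DLOGHalf] -/
@[route_item "route-QuantumAdvantage-AvgCase"]
def AvgDlogHalf : Prop :=
  ∀ pseq : ℕ → ℕ × ℕ, Literature.Computability.Complexity.PolyTimeComputable Computability.unaryEncodeNat (fun q : ℕ × ℕ => Literature.Computability.Complexity.boolPair (Computability.encodeNat q.1) (Computability.encodeNat q.2)) pseq → (∀ n, Literature.Computability.Cryptography.IsDLogInstance (pseq n).1 (pseq n).2 1) → (¬ ∃ A : Literature.Computability.Complexity.RandAlg (ℕ × ℕ) ℕ, A.IsPolyTime (fun q : ℕ × ℕ => Literature.Computability.Complexity.boolPair (Computability.unaryEncodeNat q.1) (Computability.encodeNat q.2)) Computability.encodeNat ∧ ∃ N, ∀ n ≥ N, ∀ y, Literature.Computability.Cryptography.IsDLogInstance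 (pseq n).1 (pseq n).2 y → (2 : ℝ) / 3 ≤ A.pr (fun q : ℕ × ℕ => Literature.Computability.Complexity.boolPair (Computability.unaryEncodeNat q.1) (Computability.encodeNat q.2)) (n, y) (Literature.Computability.Cryptography.dlogSolutions (pseq n).1 (pseq n).2 y)) → ∃ D ∈ Literature.Computability.MetaComplexity.PSamp, (∀ n, (D n).support ⊆ (fun y => Literature.Computability.Cryptography.encodeDLogInstance (pseq n).1 (pseq n).2 y) '' Set.Ico 1 (pseq n).1) ∧ (⟨Literature.Computability.Cryptography.DLOGHalf, D⟩ : Literature.Computability.MetaComplexity.DistProblem) ∉ Literature.Computability.MetaComplexity.HeurBPP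

/-- item stmt-QuantumAdvantage-0240 · support · rank 3 · closed · moot by None · by planner
sources: Literature.Computability.MetaComplexity.distClass_BPP_subset_HeurBPP (HeuristicClasses.lean:246) — equivalent to this item both directions, rc0 (grounder scratch/S0240.lean), BogdanovTrevisan2006 §2.3 remark after Def 2.13 (corroborated: Bogdanov-Safra FOCS 2007 p.13; AroraBarak2009 p.430 fn 2), AroraBarak2009 §7.4.1 (BPP error reduction 1/3 -> 1/4); Literature.Computability.MetaComplexity.polyTimeComputable_schemeEnc_dropParams (machine content)
A BPP decider for L (Gill/RandAlg form, Literature.Computability.Complexity.mem_BPP_iff_randAlg),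
amplified to error < 1/4 and ignoring the parameters (n, m) of schemeEnc, is a randomized heuristic
scheme whose bad-input set is empty. Needs BPP error reduction and the schemeEnc/boolPair projection
to be poly-time. Assembly lemma of the route. [BogdanovTrevisan2006 Def. 2.13 and remark;
AroraBarak2009 §7.4] -/
@[route_item "route-QuantumAdvantage-AvgCase"]
def AvgBPPSubsetHeurBPP : Prop :=
  ∀ L ∈ Literature.Computability.Complexity.BPP, ∀ D : Literature.Computability.MetaComplexity.Ensemble, (⟨L, D⟩ : Literature.Computability.MetaComplexity.DistProblem) ∈ Literature.Computability.MetaComplexity.HeurBPP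

/-- item stmt-QuantumAdvantage-0438 · support · rank 5 · closed · moot by None · by planner
sources: Shor1997 §5-6 (arXiv:quant-ph/9508027 p.16 §6 DLOG; p.18 order of g via §5) = facts Literature.Computability.Cryptography.isQSolvable_dlog, Literature.Computability.Cryptography.factoring_mem_FBQP, Bennett-Bernstein-Brassard-Vazirani 1997 (arXiv:quant-ph/9701001) Thm 4.13 p.12, Cor 4.15 p.13 (BQP^BQP = BQP), Literature.Computability.Cryptography.P_subset_BQP (closure of uniform Clifford+T families under classical poly-time control; realistically a further hypothesis)
Split off from crux #2 (stmt-QuantumAdvantage-0239) now that DLOGHalf : Language Bool has landed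
(Literature/Computability/Cryptography/DLogHalf.lean). CLAIM: assuming Shor's two theorems as named
facts (isQSolvable_dlog: a uniform Clifford+T family outputs the discrete log a of a valid instance
(p,g,y) w.p. ≥ 2/3; factoring_mem_FBQP), the Blum–Micali half language DLOGHalf = {enc(p,g,y) :
IsDLogInstance p g y ∧ 2a < p−1} is in BQP. Proof in print: on input x decode (p,g,y); check p prime
(AKS, in P ⊆ BQP) and 0<g,y<p; check g primitive by factoring p−1 (FBQP) and testing g^((p−1)/q) ≢ 1
for each prime q | p−1; run the DLOG family, verify the candidate a by modular exponentiation (so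
the 2/3 success amplifies by repetition with certainty on which run succeeded), output [2a < p−1];
reject if any check fails. Composition of BQP subroutines with classical poly-time control stays in
BQP (BQP^BQP = BQP for classical-query subroutines, Bennett–Bernstein–Brassard–Vazirani 1997 §4 /
uncompute). Sources: Shor1997 §5–6, BlumMicali1984 §3. Kill: none expected (this is the "easy"
side); informative because it exercises the tree's BQP closure API (sequential composition of
IsQSolvable families) -/
@[route_item "route-QuantumAdvantage-AvgCase"]
def AvgDloghalfMemBQP : Prop :=
  Literature.Computability.Cryptography.isQSolvable_dlog → Literature.Computability.Cryptography.factoring_mem_FBQP → Literature.Computability.Cryptography.DLOGHalf ∈ Literature.Computability.Cryptography.BQP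

/-- item stmt-QuantumAdvantage-0238 · assembly · rank 1 · closed · moot by None · by planner
If BQP = BPP then L ∈ BPP, and every BPP language is in HeurBPP on every ensemble (crux #3),
contradiction. [BogdanovTrevisan2006 §2] -/
@[route_item "route-QuantumAdvantage-AvgCase"]
def Assembly : Prop :=
  (∃ L ∈ Literature.Computability.Cryptography.BQP, ∃ D ∈ Literature.Computability.MetaComplexity.PSamp, (⟨L, D⟩ : Literature.Computability.MetaComplexity.DistProblem) ∉ Literature.Computability.MetaComplexity.HeurBPP) → QuantumAdvantage

end Summit.QuantumAdvantage.QuantumAdvantage.Theses.AvgCase
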